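import Literature.AlgebraicGeometry.HodgeTheory.CyclicCoverDeckInvariantsTransfer
import HarnessLib

/-!
# Crux K1 `VeryGeneralDeckCommutatorsInHg` (route `CyclicUnitaryPowers`, stmt-HodgeConjecture-19544): the fact
# binder `stub_ct99InvariantLine` LANDED as an unconditional theorem

The registered skeleton v9 of the crux (`Cruxes/VeryGeneralDeckCommutatorsInHg/Lines/unitary-reflection-zariski`,
planner P3 g23) binds Carlson–Toledo's invariant line (`Literature.AlgebraicGeometry.HodgeTheory.
carlsonToledo1999_finrank_eigenspace_deck_one`, Duke Math. J. 97 (1999) §2: the covering group of the cyclic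
cover `X_F = V₊(x₃^p − f) → ℙ²` has exactly a LINE of invariants in `H²(X_F(ℂ); ℚ)` — clause (iii) `Deck` of
the crux) as the stub `stub_ct99InvariantLine`. So far the tree had it only as a theorem MODULO Griffiths'
residue description of the Hodge filtration (`CyclicUnitaryPowersDeckHodgeOfGriffiths`,
`carlsonToledo1999_finrank_eigenspace_deck_one_of_residueKernel`). It is now an UNCONDITIONAL theorem of the
tree (`Literature/AlgebraicGeometry/HodgeTheory/CyclicCoverDeckInvariantsTransfer.lean`,
`carlsonToledo1999_finrank_eigenspace_deck_one_holds`: a TOPOLOGICAL proof — the transfer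
`H²(X_F(ℂ); ℚ)^{μ_p} ≅ H²(ℙ²(ℂ); ℚ) = ℚ` along the covering projection, by Bredon II.19.2 in the tree's proved
form for semi-free actions with taut fixed locus, `OrbitMap.transfer_of_semifree`; prover-Bx g7). This file
records the stub BY NAME and signature, so the binder can expire from the crux's registry. After it, Griffiths'
residue package (`Griffiths1969_residueKernel_eq_jacobianIdeal`) is consumed by K1 ONLY for the eigen-Hodge
numbers `stub_ct99EigenHodgeNumbers`; the crux itself stays conditional on the three cited facts of
`CyclicUnitaryPowersThreeFactsPL` {CT99 Picard–Lefschetz package, Griffiths residues, CDK}. Written by the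
prover seat `hodge-nonav-prover-Bx` (g7). Nothing here says HC ∕ HC_AV is proved; rung F-H1 not moved.

## References
* [CarlsonToledo1999] J. A. Carlson, D. Toledo, *Discriminant complements and kernels of monodromy
  representations*, Duke Math. J. 97 (1999), §2 (held text p0005).
* [Bredon1997] G. E. Bredon, *Sheaf Theory*, 2nd ed., GTM 170 (1997), II Thm. 19.2.
-/

noncomputable section

-- mandated namespace `Summit.HodgeConjecture.HodgeConjecture.Theorems` trips `linter.dupNamespace` (off tree-wide)
set_option linter.dupNamespace false

namespace Summit.HodgeConjecture.HodgeConjecture.Theorems.CyclicUnitaryPowersCT99InvariantLine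

/-- **Stub `stub_ct99InvariantLine` of line `unitary-reflection-zariski` (v9) of crux K1
`VeryGeneralDeckCommutatorsInHg`, PROVED unconditionally**: Carlson–Toledo's invariant line
`carlsonToledo1999_finrank_eigenspace_deck_one` holds (`carlsonToledo1999_finrank_eigenspace_deck_one_holds`,
the transfer for the deck action). [cite: CarlsonToledo1999, §2 (held text p0005)] [cite: Bredon1997, II Thm. 19.2] -/
theorem stub_ct99InvariantLine : Literature.AlgebraicGeometry.HodgeTheory.carlsonToledo1999_finrank_eigenspace_deck_one :=
  Literature.AlgebraicGeometry.HodgeTheory.carlsonToledo1999_finrank_eigenspace_deck_one_holds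

end Summit.HodgeConjecture.HodgeConjecture.Theorems.CyclicUnitaryPowersCT99InvariantLine

end
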